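import Summits.CriticalPhenomena.PercolationContinuityZ3.Theorems.PercNearOneGluingNoHeavyLowerTailCumulativeIsolation
import HarnessLib

/-!
# The registered stub `stub_monoRhoStepLadder` (lf-5 ladder line) — discharged verbatim

Support file (`--supports stmt-CriticalPhenomena-4575`), prover `prim-ineq-gen-6` (gen 11).  No definitions, no named facts,
no sorries; standard axioms.

The lf-5 "mono-ρ step ladder" stub asks, under a ladder hypothesis on the sub-systems `A ∖ y`, for the dichotomy
`(∃ a ∈ A, P(1 ≤ N ≤ j) ≤ P(|π(a)| ≤ j)) ∨ (∃ a ∈ A, P(1 ≤ N ≤ j) ≤ (|A|/(|A|−1))·c·P(|π(a)| ≤ j))`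
(`N = |C(o) ∩ A|`, `π(a) = C(a) ∩ A`).  Its FIRST disjunct is the cumulative isolation lemma `CIL_j`, now a tree theorem for
every level and every relay set (`CIL.exists_lowerTail_le`, from Kozma–Nitzan's Conjecture 4 in designated form); so the stub
holds outright — none of its hypotheses except `|A| ≥ j + 3 ≥ 3` (whence `A ≠ ∅`) is needed.
[cite: KozmaNitzan2024, Lemma 2 (p. 6), Conjecture 4 (p. 32)]
-/

noncomputable section

namespace Summit.CriticalPhenomena.PercolationContinuityZ3.Theorems

open MeasureTheory Set Literature.Probability.LatticeModels Literature.Probability.Percolation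
open scoped Classical

namespace CIL

/-- **The registered stub `stub_monoRhoStepLadder` (lf-5), verbatim**: the first disjunct is `CIL_j`
(`CIL.exists_lowerTail_le`), valid unconditionally for `A ≠ ∅`; here `|A| ≥ j + 3` gives `A ≠ ∅`.
[this work] [cite: KozmaNitzan2024, Lemma 2 (p. 6), Conjecture 4 (p. 32)] -/
theorem stub_monoRhoStepLadder :
    ∀ (j n : ℕ) (w : Sym2 (Fin n) → unitInterval) (A : Finset (Fin n)) (o : Fin n) (c : ℝ), o ∉ A → j + 3 ≤ A.card →
      A.card ≤ 2 * j + 1 → 0 ≤ c →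
      (∀ y ∈ A, ∃ a ∈ A.erase y,
        (Literature.Probability.LatticeModels.prodBernoulli w).real
            {ω : Literature.Probability.Percolation.BondConfig (Fin n) |
              1 ≤ ((A.erase y).filter fun x => ω ∈ Literature.Probability.Percolation.openConn o x).card ∧
                ((A.erase y).filter fun x => ω ∈ Literature.Probability.Percolation.openConn o x).card ≤ j} ≤
          c * (Literature.Probability.LatticeModels.prodBernoulli w).real
            {ω : Literature.Probability.Percolation.BondConfig (Fin n) |
              ((A.erase y).filter fun x => ω ∈ Literature.Probability.Percolation.openConn a x).card ≤ j}) →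
      (∃ a ∈ A, (Literature.Probability.LatticeModels.prodBernoulli w).real
          {ω : Literature.Probability.Percolation.BondConfig (Fin n) |
            1 ≤ (A.filter fun x => ω ∈ Literature.Probability.Percolation.openConn o x).card ∧
              (A.filter fun x => ω ∈ Literature.Probability.Percolation.openConn o x).card ≤ j} ≤
        (Literature.Probability.LatticeModels.prodBernoulli w).real
          {ω : Literature.Probability.Percolation.BondConfig (Fin n) |
            (A.filter fun x => ω ∈ Literature.Probability.Percolation.openConn a x).card ≤ j}) ∨
      (∃ a ∈ A, (Literature.Probability.LatticeModels.prodBernoulli w).real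
          {ω : Literature.Probability.Percolation.BondConfig (Fin n) |
            1 ≤ (A.filter fun x => ω ∈ Literature.Probability.Percolation.openConn o x).card ∧
              (A.filter fun x => ω ∈ Literature.Probability.Percolation.openConn o x).card ≤ j} ≤
        (A.card : ℝ) / ((A.card : ℝ) - 1) * c * (Literature.Probability.LatticeModels.prodBernoulli w).real
          {ω : Literature.Probability.Percolation.BondConfig (Fin n) |
            (A.filter fun x => ω ∈ Literature.Probability.Percolation.openConn a x).card ≤ j}) := by
  intro j n w A o c _ hcard _ _ _
  have hA : A.Nonempty := Finset.card_pos.1 (by omega)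
  exact Or.inl (exists_lowerTail_le w A o j hA)

end CIL

end Summit.CriticalPhenomena.PercolationContinuityZ3.Theorems

end
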